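import Literature.NumberTheory.Sieve.IwaniecAlmostPrimesProp2Lower
import Literature.NumberTheory.Sieve.IwaniecAlmostPrimesLemma2
import Literature.NumberTheory.Sieve.IwaniecAlmostPrimesProp1
import HarnessLib

/-!
# Iwaniec 1978, Theorem 1 (`n² + 1 = P₂` infinitely often) proved: `setOf_isAtMostAlmostPrime_two_sq_add_one_infinite_holds`

Topic `Literature/NumberTheory/Sieve`; sibling proof file (one theorem, no new definitions) of
`ParityWave0.lean` for the Wave-0 named fact
`Literature.NumberTheory.Sieve.setOf_isAtMostAlmostPrime_two_sq_add_one_infinite` (parity.S19):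
H. Iwaniec, *Almost-primes represented by quadratic polynomials*, Invent. Math. **47** (1978)
171–188, **Theorem 1** (p. 172): `n² + 1` has at most two prime factors for infinitely many `n`.

The tree already contains the whole printed proof; this file only joins its three leaves, which
live in three modules none of which imports the other two:

* `IwaniecAlmostPrimesProp2Lower.lean`:
  `Iwaniec1978.setOf_isAtMostAlmostPrime_two_sq_add_one_infinite_of_lemma2_of_proposition1 :
   lemma2_bilinearSieve → proposition1 → parity.S19` (Proposition 2, both halves, the weighted sum
  `W(𝒜, x^{1/5}) > (Γ/77) x/log x` of display (2), p. 173, and the deduction of Theorem 1 in §2);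
* `IwaniecAlmostPrimesLemma2.lean`: `Iwaniec1978.lemma2_bilinearSieve_holds` — Lemma 2 = Iwaniec's
  linear sieve with the bilinear form of the remainder term (Acta Arith. 37 (1980), Theorem 1);
* `IwaniecAlmostPrimesProp1.lean`: `Iwaniec1978.proposition1_holds` — Proposition 1 (p. 176), the
  dispersion estimate, from Lemmas 4–7 with Lemma 6 = Hooley's bound for incomplete Kloosterman
  sums (Weil's bound, `KloostermanWeilPrimeProofs`).

All axioms standard; no named fact remains on this path.

## References

* H. Iwaniec, *Almost-primes represented by quadratic polynomials*, Invent. Math. 47 (1978),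
  171–188, doi:10.1007/BF01578070, Theorem 1 (p. 172) and its proof in §§2–6. [IwaniecInventiones1978]
* H. Iwaniec, *A new form of the error term in the linear sieve*, Acta Arith. 37 (1980), 307–320,
  Theorem 1. [IwaniecActaArith1980b]
-/

namespace Literature.NumberTheory.Sieve

/-- **Iwaniec 1978, Theorem 1, PROVED**: there are infinitely many `n` such that `n² + 1` has at
most two prime factors, i.e. the Wave-0 named fact
`setOf_isAtMostAlmostPrime_two_sq_add_one_infinite` (parity.S19) DISCHARGED along the printed
proof: Lemma 2 (the bilinear-remainder linear sieve, `Iwaniec1978.lemma2_bilinearSieve_holds`) and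
Proposition 1 (the dispersion estimate, `Iwaniec1978.proposition1_holds`) fed into Proposition 2 and
§2 (`Iwaniec1978.setOf_isAtMostAlmostPrime_two_sq_add_one_infinite_of_lemma2_of_proposition1`).
[cite: IwaniecInventiones1978, Theorem 1 p. 172 and its proof in §§2–6] -/
theorem setOf_isAtMostAlmostPrime_two_sq_add_one_infinite_holds :
    setOf_isAtMostAlmostPrime_two_sq_add_one_infinite :=
  Iwaniec1978.setOf_isAtMostAlmostPrime_two_sq_add_one_infinite_of_lemma2_of_proposition1
    Iwaniec1978.lemma2_bilinearSieve_holds Iwaniec1978.proposition1_holds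

end Literature.NumberTheory.Sieve
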